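import Summits.NavierStokesRegularity.NavierStokesRegularity.Theses.AngularGalerkinLadder
import Summits.NavierStokesRegularity.NavierStokesRegularity.Theorems.NoOverheating.Negative.LadderLimitExposed
import Literature.Analysis.FluidPDE.ClassicalSolutionCalculus
import HarnessLib

/-!
# KJ-67 — Slices that are HOMOGENEOUS of degree `−1` (Landau-type) are excluded, exactly and
# asymptotically (route `AngularGalerkinLadder`, cruxes K1 `RungBlowupCofinal` / K2 `NoOverheating`;
# refuter lineage, Negative lane)

Stratum (S27).  The scale-invariant STEADY structure of the Navier–Stokes equations — velocity
slices homogeneous of degree `−1` in space, `λ w(λ x) = w(x)` (the Landau solutions) — is singular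
at the origin unless trivial, while rung profiles and ladder limits are continuous there:

* PROFILE-level (any `C₀`, any rotation, any factor): a rung profile whose slices `u(t, ·)`,
  `t < 0`, are `(−1)`-homogeneous under the contractions `λ ∈ (0, 1)` vanishes on the past
  (`eq_zero_of_homogeneous_of_continuousAt`: `w(x) = λ w(λ x) → 0 · w(0)` as `λ → 0⁺`); so no
  `RungIsSingular` witness and no window profile has Landau-type slices
  (`not_nontrivial_rungProfile_of_homogeneousSlices`, `no_windowProfile_homogeneousSlice`);
* SEQUENCE-level (any `C₀`, any rotations, any window): no admissible window sequence has
  ASYMPTOTICALLY `(−1)`-homogeneous window slices, `λ uₙ(−1, λ x) − uₙ(−1, x) → 0` pointwise for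
  every `λ ∈ (0, 1)` (`no_windowSequence_asymptoticallyHomogeneousSlice`): the Type-I ladder limit
  (`exists_ladderLimit_typeI`, pointwise convergence of slices, continuity, inherited floor
  `δ ≤ ‖v(−1, x₀)‖`) would have a continuous `(−1)`-homogeneous window slice.

READING FOR THE CIRCUIT: a K2 supply cannot borrow the Landau / stationary-cone scaling
`|x|⁻¹ U(x/|x|)` for its window slice, not even asymptotically along the ladder.  No `kit`.
[cite: KochNadirashviliSereginSverak2009, Lemma 6.1 (limits of rescaled solutions)] -/

namespace Summit.NavierStokesRegularity.AngularGalerkinLadderHomogeneousSlicesExcluded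

open Set Filter MeasureTheory Topology Function
open Literature.Analysis Literature.Analysis.FluidPDE
open Summit.NavierStokesRegularity.FluidComputer
open Summit.NavierStokesRegularity.FluidComputer.AngularLadder
open Summit.NavierStokesRegularity.NavierStokesRegularity.Theses.AngularGalerkinLadder
open Summit.NavierStokesRegularity.AngularGalerkinLadderLadderLimit

/-! ## §1 A `(−1)`-homogeneous field continuous at the origin vanishes -/

/-- **Homogeneity of degree `−1` under contractions + continuity at `0` ⇒ zero.**  If
`λ w(λ x) = w(x)` for all `λ ∈ (0, 1)` and `w` is continuous at the origin, then `w ≡ 0`: along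
`λₖ = 1/(k+2) → 0⁺`, `w(x) = λₖ w(λₖ x) → 0 · w(0) = 0`. [folklore] -/
theorem eq_zero_of_homogeneous_of_continuousAt
    {w : EuclideanSpace ℝ (Fin 3) → EuclideanSpace ℝ (Fin 3)} (hw : ContinuousAt w 0)
    (hhom : ∀ lam : ℝ, 0 < lam → lam < 1 → ∀ x, lam • w (lam • x) = w x) : ∀ x, w x = 0 := by
  intro x
  -- the contractions `λₖ = 1/(k+2)`
  have hl : Tendsto (fun k : ℕ => (1 : ℝ) / ((k : ℝ) + 2)) atTop (𝓝 0) := by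
    have h := (tendsto_one_div_add_atTop_nhds_zero_nat :
      Tendsto (fun n : ℕ => (1 : ℝ) / ((n : ℝ) + 1)) atTop (𝓝 0)).comp (tendsto_add_atTop_nat 1)
    refine h.congr fun k => ?_
    simp only [Function.comp]
    push_cast
    ring
  have hl0 : ∀ k : ℕ, (0 : ℝ) < 1 / ((k : ℝ) + 2) := fun k => by positivity
  have hl1 : ∀ k : ℕ, (1 : ℝ) / ((k : ℝ) + 2) < 1 := fun k => by
    rw [div_lt_one (by positivity)]
    have : (0 : ℝ) ≤ k := Nat.cast_nonneg k
    linarith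
  have hwx : Tendsto (fun k : ℕ => w (((1 : ℝ) / ((k : ℝ) + 2)) • x)) atTop (𝓝 (w 0)) := by
    have h1 : Tendsto (fun k : ℕ => ((1 : ℝ) / ((k : ℝ) + 2)) • x) atTop (𝓝 0) := by
      simpa using hl.smul_const x
    exact hw.tendsto.comp h1
  have hlim : Tendsto (fun k : ℕ => ((1 : ℝ) / ((k : ℝ) + 2)) • w (((1 : ℝ) / ((k : ℝ) + 2)) • x))
      atTop (𝓝 0) := by
    simpa using hl.smul hwx
  have hconst : Tendsto (fun k : ℕ => ((1 : ℝ) / ((k : ℝ) + 2)) • w (((1 : ℝ) / ((k : ℝ) + 2)) • x))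
      atTop (𝓝 (w x)) := by
    have hE : (fun k : ℕ => ((1 : ℝ) / ((k : ℝ) + 2)) • w (((1 : ℝ) / ((k : ℝ) + 2)) • x)) =
        fun _ => w x := funext fun k => hhom _ (hl0 k) (hl1 k) x
    rw [hE]
    exact tendsto_const_nhds
  exact tendsto_nhds_unique hconst hlim

/-! ## §2 (S27) PROFILE-level: Landau-type slices are excluded -/

section Profile

variable {L : ℕ} {C₀ c : ℝ} {R : EuclideanSpace ℝ (Fin 3) ≃ₗᵢ[ℝ] EuclideanSpace ℝ (Fin 3)}
  {u : ℝ → EuclideanSpace ℝ (Fin 3) → EuclideanSpace ℝ (Fin 3)}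
  {p : ℝ → EuclideanSpace ℝ (Fin 3) → ℝ}
  {d : ℝ → EuclideanSpace ℝ (Fin 3) → EuclideanSpace ℝ (Fin 3)}

/-- **(S27) A rung profile with a `(−1)`-homogeneous slice has that slice zero** (classical ⇒ the
slice is continuous at the origin). -/
theorem rungProfile_slice_eq_zero_of_homogeneous (hP : IsRungProfile L C₀ c R u p d) {t : ℝ}
    (ht : t < 0) (hhom : ∀ lam : ℝ, 0 < lam → lam < 1 → ∀ x, lam • u t (lam • x) = u t x) :
    ∀ x, u t x = 0 :=
  eq_zero_of_homogeneous_of_continuousAt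
    (continuous_slice_of_continuousOn_Iio hP.classical.smooth_velocity.continuousOn
      ht).continuousAt hhom

/-- **(S27) for K1's witnesses**: a rung profile all of whose slices `u(t, ·)`, `t < 0`, are
`(−1)`-homogeneous under contractions is not a `RungIsSingular` witness. -/
theorem not_nontrivial_rungProfile_of_homogeneousSlices (hP : IsRungProfile L C₀ c R u p d)
    (hhom : ∀ t < 0, ∀ lam : ℝ, 0 < lam → lam < 1 → ∀ x, lam • u t (lam • x) = u t x) :
    ¬ ∃ t < 0, ∃ x, u t x ≠ 0 :=
  fun ⟨t, ht, x, hx⟩ => hx (rungProfile_slice_eq_zero_of_homogeneous hP ht (hhom t ht) x)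

/-- **(S27) for K2's windows**: no window profile (`0 < δ`) has a `(−1)`-homogeneous window
slice `u(−1, ·)` — ANY `C₀`, ANY window, ANY rotation. -/
theorem no_windowProfile_homogeneousSlice {cmin cmax δ ε : ℝ} (hδ : 0 < δ)
    (hW : IsWindowProfile L C₀ cmin cmax δ ε c R u p d)
    (hhom : ∀ lam : ℝ, 0 < lam → lam < 1 → ∀ x, lam • u (-1) (lam • x) = u (-1) x) : False := by
  obtain ⟨hP, -, -, ⟨x₀, hx₀⟩, -⟩ := hW
  rw [rungProfile_slice_eq_zero_of_homogeneous hP (by norm_num) hhom x₀, norm_zero] at hx₀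
  exact absurd hx₀ (not_le.2 hδ)

end Profile

/-! ## §3 (S27) SEQUENCE-level: no asymptotically homogeneous window slices -/

variable {C₀ cmin cmax δ : ℝ} {L : ℕ → ℕ} {ε c : ℕ → ℝ}
  {R : ℕ → (EuclideanSpace ℝ (Fin 3) ≃ₗᵢ[ℝ] EuclideanSpace ℝ (Fin 3))}
  {u : ℕ → ℝ → EuclideanSpace ℝ (Fin 3) → EuclideanSpace ℝ (Fin 3)}
  {p : ℕ → ℝ → EuclideanSpace ℝ (Fin 3) → ℝ}
  {d : ℕ → ℝ → EuclideanSpace ℝ (Fin 3) → EuclideanSpace ℝ (Fin 3)}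

/-- **(S27) No admissible window sequence has asymptotically `(−1)`-homogeneous window slices.**
`1 < cmin`, `0 < δ`, `εₙ → 0`, window rung profiles with constant `C₀` — ANY `C₀`, ANY rotations,
ANY window — and `λ uₙ(−1, λ x) − uₙ(−1, x) → 0` pointwise for every `λ ∈ (0, 1)` are
contradictory: the window slice `v(−1, ·)` of the Type-I ladder limit (`exists_ladderLimit_typeI`)
is continuous, `(−1)`-homogeneous under contractions, hence zero — against the inherited floor
`δ ≤ ‖v(−1, x₀)‖`. [cite: KochNadirashviliSereginSverak2009, Lemma 6.1 (limits of rescaled solutions)] -/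
theorem no_windowSequence_asymptoticallyHomogeneousSlice (hcmin : 1 < cmin) (hδ : 0 < δ)
    (hε : Tendsto ε atTop (𝓝 0))
    (hW : ∀ n, IsWindowProfile (L n) C₀ cmin cmax δ (ε n) (c n) (R n) (u n) (p n) (d n))
    (hdef : ∀ lam : ℝ, 0 < lam → lam < 1 → ∀ x,
      Tendsto (fun n => lam • u n (-1) (lam • x) - u n (-1) x) atTop (𝓝 0)) : False := by
  obtain ⟨φ, c', R', v, hφ, -, -, -, hptw, -, hvcont, -, -, -, -, -, ⟨x₀, hx₀⟩, -⟩ :=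
    exists_ladderLimit_typeI hcmin hδ hε hW
  have hhom : ∀ lam : ℝ, 0 < lam → lam < 1 → ∀ x, lam • v (-1) (lam • x) = v (-1) x := by
    intro lam hlam0 hlam1 x
    have h1 : Tendsto (fun n => lam • u (φ n) (-1) (lam • x) - u (φ n) (-1) x) atTop
        (𝓝 (lam • v (-1) (lam • x) - v (-1) x)) :=
      ((hptw (-1) (by norm_num) (lam • x)).const_smul lam).sub (hptw (-1) (by norm_num) x)
    have h0 : lam • v (-1) (lam • x) - v (-1) x = 0 :=
      tendsto_nhds_unique h1 ((hdef lam hlam0 hlam1 x).comp hφ.tendsto_atTop)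
    exact sub_eq_zero.1 h0
  have hz := eq_zero_of_homogeneous_of_continuousAt
    (continuous_slice_of_continuousOn_Iio hvcont (by norm_num : (-1 : ℝ) < 0)).continuousAt hhom
  rw [hz x₀, norm_zero] at hx₀
  exact absurd hx₀ (not_le.2 hδ)

/-- **(S27) in census form.** -/
theorem no_windowSequence_asymptoticallyHomogeneousSlice_census (hcmin : 1 < cmin) (hδ : 0 < δ)
    (hε : Tendsto ε atTop (𝓝 0))
    (hW : ∀ n, IsWindowProfile (L n) C₀ cmin cmax δ (ε n) (c n) (R n) (u n) (p n) (d n)) :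
    ¬ (∀ lam : ℝ, 0 < lam → lam < 1 → ∀ x,
        Tendsto (fun n => lam • u n (-1) (lam • x) - u n (-1) x) atTop (𝓝 0)) :=
  fun hdef => no_windowSequence_asymptoticallyHomogeneousSlice hcmin hδ hε hW hdef

end Summit.NavierStokesRegularity.AngularGalerkinLadderHomogeneousSlicesExcluded
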